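import Summits.Ventures.PercRepro.RankLevelSetLevelSixT19Cell7
import Summits.Ventures.PercRepro.RankLevelSetLevelSixT19Cell8
import Summits.Ventures.PercRepro.RankLevelSetLevelSixT19Cell9
import Summits.Ventures.PercRepro.RankLevelSetLevelSixT19Cell10
import Summits.Ventures.PercRepro.RankLevelSetLevelSixT19Cell11
import Summits.Ventures.PercRepro.RankLevelSetLevelSixT19Cell12
import Summits.Ventures.PercRepro.RankLevelSetLevelSixT19Cell13
import Summits.Ventures.PercRepro.RankLevelSetLevelSixT19Cell14
import Summits.Ventures.PercRepro.RankLevelSetLevelSixT19Cell15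
import Summits.Ventures.PercRepro.RankLevelSetLevelSixT19Cell16
import Summits.Ventures.PercRepro.RankLevelSetLevelSixT19Cell17
import Summits.Ventures.PercRepro.RankLevelSetLevelSixT19Cell18
import Summits.Ventures.PercRepro.RankLevelSetLevelSixT19Cell19
import Summits.Ventures.PercRepro.RankLevelSetLevelSixT19Cell20
import Summits.Ventures.PercRepro.RankLevelSetLevelSixT19Cell21
import Summits.Ventures.PercRepro.RankLevelSetLevelSixT19Cell22
import Summits.Ventures.PercRepro.RankLevelSetLevelSixT19Cell23
import Summits.Ventures.PercRepro.RankLevelSetLevelSixT19Cell32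
import Summits.Ventures.PercRepro.RankLevelSetLevelSixT19Cell33
import Summits.Ventures.PercRepro.RankLevelSetLevelSixT19Cell34
import Summits.Ventures.PercRepro.RankLevelSetLevelSixT19BasisMid1
import Summits.Ventures.PercRepro.RankLevelSetLevelSixT19BasisMid2
import Summits.Ventures.PercRepro.RankLevelSetLevelSixT19BasisMid3
import Summits.Ventures.PercRepro.RankLevelSetLevelSixT19RegII
import Summits.Ventures.PercRepro.RankLevelSetLevelSixT20Assembly
import Summits.Ventures.PercRepro.RankLevelSetLevelFiveCqFifteen

/-!
# PercRepro — THE 19 ROW: `c025_six_large_nineteen (19 ≤ p) : RLS M p 6` — C-025 AT LEVEL `6` FOR EVERY `p ≥ 19`, EVERY FINITE MATROID (p8 g15, S3)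

The core cells `(19, d)`: `d ∈ [7, 8, 9, 10, 11, 12, 13, 14, 15, 16, 17, 18, 19, 20, 21, 22, 23, 32, 33, 34]` by THE COLOOP DEVICE WITH THE LP CHAIN (`c025_core_six_nineteen_d`: `k = 0` and the chain
steps the coloop-free cells of p2's nullity-split coloop/closure LP run at level `6` (`S3LP.s6lp_*`, natural or scaled), then the
exported-count rows and the trivial rows), `23 … 31, 35 … 43, 44 … 46` by the basis cells
(`c025_core_six_t19_basis_mid1, c025_core_six_t19_basis_mid2, c025_core_six_t19_basis_mid3`), `d ≥ 47` by regime II (`c025_core_six_regII_basis_19`). Then the level-5 glue: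
`rls_six_at_of_core 19` on p7's `c025_five_large_sharp15` (level `5` at `p = 18`) and the 20 row (`c025_six_large_twenty`) for `p ≥ 20`.
Axioms: standard.
-/

open scoped Matroid

namespace PercRepro

namespace ThmN

variable {α : Type}

/-- **The core cell `(19, d)` at every corank `d ≥ 35`, every `e`-free core** (the basis cells and regime II). -/
theorem c025_core_six_nineteen_large (M : Matroid α) [M.Finite] (d : ℕ) (hd : 35 ≤ d)
    (hR : M.eRank = (19 : ℕ∞)) (hn : M.E.ncard = 19 + d)
    (hfree : ∀ e ∈ M.E, ∃ A ⊆ M.E \ {e}, e ∉ M.closure A ∧ e ∉ M.closure ((M.E \ {e}) \ A)) :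
    RLS M 19 6 := by
  rcases Nat.lt_or_ge d 44 with h43 | h43'
  · exact c025_core_six_t19_basis_mid2 M d (by omega) (by omega) hR hn hfree
  rcases Nat.lt_or_ge d 47 with h46 | h46'
  · exact c025_core_six_t19_basis_mid3 M d (by omega) (by omega) hR hn hfree
  exact c025_core_six_regII_basis_19 M d (by omega) hR hn hfree

/-- **The core cell `(19, d)` at every corank `d ≥ 7`, every `e`-free core.** -/
theorem c025_core_six_nineteen (M : Matroid α) [M.Finite] (d : ℕ) (hd7 : 7 ≤ d)
    (hR : M.eRank = (19 : ℕ∞)) (hn : M.E.ncard = 19 + d)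
    (hfree : ∀ e ∈ M.E, ∃ A ⊆ M.E \ {e}, e ∉ M.closure A ∧ e ∉ M.closure ((M.E \ {e}) \ A)) :
    RLS M 19 6 := by
  rcases Nat.lt_or_ge d 35 with hlt | hge
  · interval_cases d
    · exact c025_core_six_nineteen_7 M hR hn hfree
    · exact c025_core_six_nineteen_8 M hR hn hfree
    · exact c025_core_six_nineteen_9 M hR hn hfree
    · exact c025_core_six_nineteen_10 M hR hn hfree
    · exact c025_core_six_nineteen_11 M hR hn hfree
    · exact c025_core_six_nineteen_12 M hR hn hfree
    · exact c025_core_six_nineteen_13 M hR hn hfree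
    · exact c025_core_six_nineteen_14 M hR hn hfree
    · exact c025_core_six_nineteen_15 M hR hn hfree
    · exact c025_core_six_nineteen_16 M hR hn hfree
    · exact c025_core_six_nineteen_17 M hR hn hfree
    · exact c025_core_six_nineteen_18 M hR hn hfree
    · exact c025_core_six_nineteen_19 M hR hn hfree
    · exact c025_core_six_nineteen_20 M hR hn hfree
    · exact c025_core_six_nineteen_21 M hR hn hfree
    · exact c025_core_six_nineteen_22 M hR hn hfree
    · exact c025_core_six_nineteen_23 M hR hn hfree
    · exact c025_core_six_t19_basis_mid1 M 24 (by norm_num) (by norm_num) hR hn hfree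
    · exact c025_core_six_t19_basis_mid1 M 25 (by norm_num) (by norm_num) hR hn hfree
    · exact c025_core_six_t19_basis_mid1 M 26 (by norm_num) (by norm_num) hR hn hfree
    · exact c025_core_six_t19_basis_mid1 M 27 (by norm_num) (by norm_num) hR hn hfree
    · exact c025_core_six_t19_basis_mid1 M 28 (by norm_num) (by norm_num) hR hn hfree
    · exact c025_core_six_t19_basis_mid1 M 29 (by norm_num) (by norm_num) hR hn hfree
    · exact c025_core_six_t19_basis_mid1 M 30 (by norm_num) (by norm_num) hR hn hfree
    · exact c025_core_six_t19_basis_mid1 M 31 (by norm_num) (by norm_num) hR hn hfree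
    · exact c025_core_six_nineteen_32 M hR hn hfree
    · exact c025_core_six_nineteen_33 M hR hn hfree
    · exact c025_core_six_nineteen_34 M hR hn hfree
  · exact c025_core_six_nineteen_large M d hge hR hn hfree

/-- **THEOREM C₆ AT RANK `19`, GIVEN LEVEL `5`**: level `5` for all `p ≥ 18` implies level `6` for all `p ≥ 19`
(`p = 19` by the cells and `rls_six_at_of_core`; `p ≥ 20` by the 20 row). -/
theorem c025_six_of_five_t19
    (h5 : ∀ (M : Matroid α) [M.Finite] (p : ℕ), 18 ≤ p → RLS M p 5) :
    ∀ (M : Matroid α) [M.Finite] (p : ℕ), 19 ≤ p → RLS M p 6 := by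
  intro M _ p hp
  rcases Nat.lt_or_ge p 20 with hlt | hge
  · have hP : p = 19 := by omega
    subst hP
    refine rls_six_at_of_core 19 (by norm_num) (fun M _ => h5 M 18 (by norm_num)) ?_ M
    intro M _ d hd hR hn hfree
    exact c025_core_six_nineteen M d hd hR hn hfree
  · exact c025_six_large_twenty M p hge

/-- **C-025 AT LEVEL `6` FOR EVERY `p ≥ 19`, EVERY FINITE MATROID** — on p7's `c025_five_large_sharp15 (15 ≤ p)`. -/
theorem c025_six_large_nineteen (M : Matroid α) [M.Finite] (p : ℕ) (hp : 19 ≤ p) : RLS M p 6 :=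
  c025_six_of_five_t19 (fun M _ p hp => c025_five_large_sharp15 M p (by omega)) M p hp

end ThmN

end PercRepro
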